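import Summits.QuantumFields.BalabanUV.T4Continuum.Support.MinimalActionRate
import Literature.MathematicalPhysics.QuantumFieldTheory.Balaban1983to89.B7Prop1Local
import HarnessLib

/-!
# NE7DatumRefinement — THE EXACT REFINEMENT OF A DATUM ([Balaban1985Variational] Sect. A (11), p. 279): for every bond configuration `D` of the
# period-`N` lattice there is a configuration `D₀` of the period-`N·L` lattice whose ONE-STEP AVERAGE (42)∕(43) IS `D` — `rescale L (bavg L D₀) = D`
# EXACTLY — with the SAME plaquette radius, unitary and periodic with `D`; hence a level-`j` admissible configuration over `D₀` is a level-`(j+1)`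
# admissible configuration over `D` (the re-reading that drives B11's induction on `k`)

Cell `pub-balaban`, rung (B)+1 sub-cell t4, lineage `b2b-balaban-t4-ne7-p1` (CRUX PROVER NE7 #1 = OWNER of row NE7), generation 88; memo
`t4/b2b-balaban-t4-ne7-p1-g88/EXISTENCE-BY-INDUCTION.md` §2.  File F239 (over `MinimalActionRate` ∕ `MinimalActionSandwich` ∕ `MinimalActionLevels` and the
tree's B7 lattice calculus `B7Prop1Explicit`, `B7Prop1Local.hol_plaqWord_eq`).

WHY.  [Balaban1985Variational] proves Thm 1 by induction on `k` (p. 279); the inductive step (Sect. A) starts from «a configuration `V₀` on `𝔅_{k−1}` such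
that it satisfies (7) on `𝔅_{k−1}`, and `V̄₀ = V`» ((11): `V₀ = V` on one bond per averaging contour, `1` on the remaining bonds), so that the previous
minimiser `U_{k−1}(V₀)` lies on the fibre of `V` one level up and serves as the background.  THIS FILE is that construction for the tree's averaging
(42) (`B7Prop1Explicit.bavg`: `V̄_c = exp[Σ_{x∈B(c₋)} L^{−d} log V(Γ_{c,x})V(c)⁻¹]·V(c)`, `Γ_{c,x} =` tree contour `++` straight segment `++` reversed tree
contour): the SLAB configuration `D₀(x, κ) = D(⌊x∕L⌋, κ)` if `x_κ ≡ L − 1 (mod L)`, `= 1` otherwise.  Every tree contour inside a block and every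
straight segment meets exactly the bonds on which `D₀` is `1`, except the ONE bond of the segment in the last slab, where it is `D(⌊x∕L⌋, κ)`; so every
`V(Γ_{c,x})V(c)⁻¹ = 1`, the exponent of (42) vanishes, and `V̄_c = V(c) = D(c)`.  The fine plaquettes of `D₀` are `1` or a plaquette of `D`.
WHAT ([folklore] lattice bookkeeping; 0 def — the slab configuration is characterised by its two defining clauses `hR1`, `hR0` and produced inside the
existence theorem; 0 sorry).
§1 `hol_seg_eq_one_of`, `hol_flatMap_seg_eq_one`, `hol_treeWord_eq_one_of` — holonomies along positive segments ∕ tree contours all of whose bonds carry `1`.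
§2 for a slab configuration `R` over `D` (`hR1 : x_κ % L ≠ L−1 → R x κ = 1`, `hR0 : x_κ % L = L−1 → R x κ = D ⌊x∕L⌋ κ`): `hol_treeWord_slab` (`= 1` from a
   block corner), `hol_seg_slab` (`= D y κ` from any point of the block `B(L•y)`), `Wcx_slab` (`= 1`), `Xavg_slab` (`= 0`), **`bavg_slab`** (`V̄ = D`),
   `rescale_bavg_slab`, `avgIter_one_slab`; class transport `isUnitaryCfg_slab`, `isPeriodicCfg_slab` (period `N·L` from period `N`), **`smallField_slab`**
   (SAME radius).
§3 **`exists_datumRefinement`** — `∃ D₀`, unitary, `(N·L)`-periodic, `SmallField D₀ a`, `rescale L (bavg L D₀) = D`; **`mem_admissible_succ_of_top`** — `U₀ ∈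
   admissible 𝒞′ L j D₀`, `rescale L (bavg L D₀) = D`, `U₀ ∈ 𝒞 (j+1)` ⟹ `U₀ ∈ admissible 𝒞 L (j+1) D`; **`mem_sfClass_succ_of_mul`** — `U₀ ∈ sfClass d L (N·L) ε j`
   with `SmallField U₀ (δ₁∕(L^j)²)`, `δ₁L² ≤ ε` ⟹ `U₀ ∈ sfClass d L N ε (j+1)`; **`mem_admissible_sfClass_succ`** — both at once.
HONEST FRAMING (page 1): an elementary lattice construction (one configuration, one averaging step, no estimate, no minimiser); nothing of Bałaban's
asserted — (11) p. 279 is quoted for what it CONSTRUCTS; NOT ONE-STEP, NOT NE7; spine 0∕9; finite T⁴ rung (B)+1 — NOT infinite volume, NOT mass gap, NOT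
`BetaPertH`, NOT Clay.  Continuum YM on T⁴ ⇐ BetaPertH ∧ nine spine estimates (0/9 proved); BetaPertH ⇐ (D1) ∧ (D4) ∧ CAP+tail; G-an2-4 gates asym, D1
and NE2/3/4.
-/

set_option autoImplicit false

open scoped BigOperators Matrix Matrix.Norms.L2Operator
open NormedSpace Finset

namespace Summit.QuantumFields.BalabanUV.T4Continuum.NE7DatumRefinement

open Literature.MathematicalPhysics.QuantumFieldTheory.Balaban1983to89
open B7Prop1Explicit B7Prop2Explicit MatrixLog
open B7Prop1Local (hol_plaqWord_eq)
open T4AveragingDeficitWall (IsUnitaryCfg SmallField)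
open T4AveragingDeficitWallBoundary (IsPeriodicCfg)
open MinimalActionSandwich (admissible)
open MinimalActionRate (sfClass)

noncomputable section

variable {d : ℕ} {n : Type*} [Fintype n] [DecidableEq n]

/-! ## §1 Holonomies along positive segments and tree contours whose bonds all carry `1` -/

section Words

variable {G : Type*} [Group G]

/-- A positive straight segment all of whose bonds carry `1` has holonomy `1`. [folklore] -/
theorem hol_seg_eq_one_of (V : Site d → Fin d → G) (z : Site d) (κ : Fin d) :
    ∀ m : ℕ, (∀ t : ℕ, t < m → V (z + (t : ℤ) • e κ) κ = 1) → hol V z (seg κ (m : ℤ)) = 1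
  | 0, _ => by simp
  | m + 1, h => by
    rw [show ((m + 1 : ℕ) : ℤ) = (m : ℤ) + 1 by push_cast; ring, hol_seg_natCast_succ,
      hol_seg_eq_one_of V z κ m fun t ht => h t (by omega), h m (by omega), one_mul]

/-- A concatenation of positive segments in DISTINCT directions, each bond of which carries `1`, has holonomy `1`; the bonds of the segment in
direction `κ` have `κ`-coordinate `x_κ + t`, `0 ≤ t < v_κ` (the earlier segments do not move the `κ`-coordinate). [folklore] -/
theorem hol_flatMap_seg_eq_one (V : Site d → Fin d → G) :
    ∀ (s : List (Fin d)), s.Nodup → ∀ (x v : Site d), (∀ κ ∈ s, 0 ≤ v κ) →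
      (∀ κ ∈ s, ∀ t : ℤ, 0 ≤ t → t < v κ → ∀ z : Site d, z κ = x κ + t → V z κ = 1) →
      hol V x (s.flatMap fun κ => seg κ (v κ)) = 1
  | [], _, x, v, _, _ => by simp
  | κ :: s, hs, x, v, hv, h => by
    rw [List.nodup_cons] at hs
    rw [List.flatMap_cons, hol_append, disp_seg]
    have hκ0 : 0 ≤ v κ := hv κ (by simp)
    obtain ⟨m, hm⟩ := Int.eq_ofNat_of_zero_le hκ0
    have h1 : hol V x (seg κ (v κ)) = 1 := by
      rw [hm]
      refine hol_seg_eq_one_of V x κ m fun t ht => h κ (by simp) t (by omega) (by rw [hm]; exact_mod_cast ht) _ ?_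
      simp [e_apply]
    have h2 : hol V (x + v κ • e κ) (s.flatMap fun κ' => seg κ' (v κ')) = 1 := by
      refine hol_flatMap_seg_eq_one V s hs.2 (x + v κ • e κ) v (fun κ' hκ' => hv κ' (by simp [hκ'])) ?_
      intro κ' hκ' t ht0 ht z hz
      have hne : κ' ≠ κ := fun heq => hs.1 (heq ▸ hκ')
      refine h κ' (by simp [hκ']) t ht0 ht z ?_
      rw [hz]; simp [e_apply, hne]
    rw [h1, h2, one_mul]

/-- The tree contour `Γ_{x, x+v}` (`v ≥ 0` coordinatewise) has holonomy `1` as soon as every bond `⟨z, z + e_κ⟩` with `z_κ = x_κ + t`, `0 ≤ t < v_κ`,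
carries `1`. [folklore] -/
theorem hol_treeWord_eq_one_of (V : Site d → Fin d → G) (x v : Site d) (hv : ∀ κ, 0 ≤ v κ)
    (h : ∀ (κ : Fin d) (t : ℤ), 0 ≤ t → t < v κ → ∀ z : Site d, z κ = x κ + t → V z κ = 1) :
    hol V x (treeWord v) = 1 :=
  hol_flatMap_seg_eq_one V _ (List.nodup_reverse.mpr (List.nodup_finRange d)) x v (fun κ _ => hv κ) fun κ _ => h κ

end Words

/-! ## §2 The slab configuration over a datum `D`: its average IS `D`, its class is that of `D` -/

section Slab

/-- Integer bookkeeping: `(L·y + s) % L = s` and `(L·y + s) ∕ L = y` for `0 ≤ s < L`. [folklore] -/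
theorem emod_ediv_block {L : ℕ} (hL : 1 ≤ L) (y s : ℤ) (hs0 : 0 ≤ s) (hsL : s < L) :
    ((L : ℤ) * y + s) % (L : ℤ) = s ∧ ((L : ℤ) * y + s) / (L : ℤ) = y := by
  have hL0 : (L : ℤ) ≠ 0 := by exact_mod_cast (by omega : L ≠ 0)
  constructor
  · rw [add_comm, Int.add_mul_emod_self_left, Int.emod_eq_of_lt hs0 hsL]
  · rw [add_comm, Int.add_mul_ediv_left _ _ hL0, Int.ediv_eq_zero_of_lt hs0 hsL, zero_add]

/-- From a block corner `L•y`, the tree contour to any point of the block `B(L•y)` (offset `ρ ∈ [0, L)^d`) sees only bonds on which the slab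
configuration is `1`. [folklore] -/
theorem hol_treeWord_slab {L : ℕ} {R : Site d → Fin d → (Matrix n n ℂ)ˣ} (hL : 1 ≤ L) (hR1 : ∀ (x : Site d) (κ : Fin d), x κ % (L : ℤ) ≠ L - 1 → R x κ = 1)
    (y ρ : Site d) (hρ0 : ∀ i, 0 ≤ ρ i) (hρL : ∀ i, ρ i ≤ (L : ℤ) - 1) :
    hol R ((L : ℤ) • y) (treeWord ρ) = 1 := by
  refine hol_treeWord_eq_one_of R _ ρ hρ0 fun κ t ht0 ht z hz => hR1 z κ ?_
  have hres : z κ % (L : ℤ) = t := by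
    rw [hz, Pi.smul_apply, smul_eq_mul]; exact (emod_ediv_block hL (y κ) t ht0 (by linarith [hρL κ])).1
  rw [hres]; have := hρL κ; omega

/-- From any point `L•y + ρ` of the block `B(L•y)` (`ρ ∈ [0, L)^d`), the straight segment of `L` steps in direction `κ` has holonomy `D y κ` under the
slab configuration: exactly one of its bonds lies in the last slab of the block, and there `R = D(⌊·∕L⌋, κ) = D y κ`. [folklore] -/
theorem hol_seg_slab {L : ℕ} {D R : Site d → Fin d → (Matrix n n ℂ)ˣ} (hL : 1 ≤ L) (hR1 : ∀ (x : Site d) (κ : Fin d), x κ % (L : ℤ) ≠ L - 1 → R x κ = 1)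
    (hR0 : ∀ (x : Site d) (κ : Fin d), x κ % (L : ℤ) = L - 1 → R x κ = D (fun i => x i / (L : ℤ)) κ)
    (y ρ : Site d) (hρ0 : ∀ i, 0 ≤ ρ i) (hρL : ∀ i, ρ i ≤ (L : ℤ) - 1) (κ : Fin d) :
    hol R ((L : ℤ) • y + ρ) (seg κ (L : ℤ)) = D y κ := by
  -- split the segment after `t₀ = L − 1 − ρ_κ` steps: `seg L = seg t₀ ++ (κ,+) :: seg m`, `m = ρ_κ`
  obtain ⟨m, hm⟩ := Int.eq_ofNat_of_zero_le (hρ0 κ)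
  have hmL : m + 1 ≤ L := by have := hρL κ; rw [hm] at this; omega
  set t₀ : ℕ := L - 1 - m with ht₀
  have hsplit : seg κ (L : ℤ) = seg κ (t₀ : ℤ) ++ ((κ, true) :: seg κ (m : ℤ)) := by
    rw [seg_natCast, seg_natCast, seg_natCast, ← List.replicate_succ, ← List.replicate_add]
    congr 1; omega
  set x : Site d := (L : ℤ) • y + ρ with hx
  have hxi : ∀ i, x i = (L : ℤ) * y i + ρ i := fun i => by simp [hx]
  rw [hsplit, hol_append, disp_seg, hol_cons, stepHol_true, Letter.vec_true]
  -- the first `t₀` bonds: `κ`-coordinate `L y_κ + (m + t)`, `m + t ≤ L − 2`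
  have h1 : hol R x (seg κ (t₀ : ℤ)) = 1 := by
    refine hol_seg_eq_one_of R x κ t₀ fun t ht => hR1 _ κ ?_
    have hc : (x + (t : ℤ) • e κ) κ = (L : ℤ) * y κ + (ρ κ + t) := by simp [hxi, e_apply]; ring
    rw [hc, (emod_ediv_block hL (y κ) _ (by rw [hm]; positivity) (by rw [hm]; omega)).1, hm]
    omega
  -- the bond in the last slab
  have h2 : R (x + (t₀ : ℤ) • e κ) κ = D y κ := by
    have hc : ∀ i, (x + (t₀ : ℤ) • e κ) i = (L : ℤ) * y i + (ρ i + if i = κ then (t₀ : ℤ) else 0) := by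
      intro i; simp [hxi, e_apply]; split_ifs <;> ring
    have hsl : ∀ i, 0 ≤ ρ i + (if i = κ then (t₀ : ℤ) else 0) ∧ ρ i + (if i = κ then (t₀ : ℤ) else 0) < L := by
      intro i
      split_ifs with hi
      · subst hi; rw [hm]; constructor
        · positivity
        · omega
      · simp only [add_zero]; exact ⟨hρ0 i, by linarith [hρL i]⟩
    rw [hR0 _ κ]
    · congr 1; funext i; rw [hc i]; exact (emod_ediv_block hL (y i) _ (hsl i).1 (hsl i).2).2
    · rw [hc κ, (emod_ediv_block hL (y κ) _ (hsl κ).1 (hsl κ).2).1, if_pos rfl, hm, ht₀]; omega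
  -- the last `m` bonds: `κ`-coordinate `L (y_κ + 1) + t`, `t ≤ m − 1 ≤ L − 2`
  have h3 : hol R (x + (t₀ : ℤ) • e κ + e κ) (seg κ (m : ℤ)) = 1 := by
    refine hol_seg_eq_one_of R _ κ m fun t ht => hR1 _ κ ?_
    have hc : (x + (t₀ : ℤ) • e κ + e κ + (t : ℤ) • e κ) κ = (L : ℤ) * (y κ + 1) + t := by
      simp [hxi, e_apply, hm, ht₀]; ring_nf; omega
    rw [hc, (emod_ediv_block hL (y κ + 1) t (by positivity) (by omega)).1]
    omega
  rw [h1, h2, h3, one_mul, mul_one]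

/-- The argument `V(Γ_{c,x})V(c)⁻¹` of the logarithm in (42) is `1` for the slab configuration, at every `L`-bond `c = ⟨L•y, L•y + Le_κ⟩` and every
`x = L•y + r` of its block. [folklore] -/
theorem Wcx_slab {L : ℕ} {D R : Site d → Fin d → (Matrix n n ℂ)ˣ} [NeZero L] (hL : 1 ≤ L) (hR1 : ∀ (x : Site d) (κ : Fin d), x κ % (L : ℤ) ≠ L - 1 → R x κ = 1)
    (hR0 : ∀ (x : Site d) (κ : Fin d), x κ % (L : ℤ) = L - 1 → R x κ = D (fun i => x i / (L : ℤ)) κ)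
    (y : Site d) (κ : Fin d) (r : Fin d → Fin L) :
    Wcx L R ((L : ℤ) • y) κ (boxVec L r) = 1 := by
  have hρ0 : ∀ i, 0 ≤ boxVec L r i := fun i => by simp [boxVec]
  have hρL : ∀ i, boxVec L r i ≤ (L : ℤ) - 1 := fun i => by
    have := (r i).isLt; simp only [boxVec]; omega
  have h0 : ∀ i, (0 : Site d) i ≤ (L : ℤ) - 1 := fun i => by simp; omega
  have hsegc : hol R ((L : ℤ) • y) (seg κ (L : ℤ)) = D y κ := by
    simpa using hol_seg_slab hL hR1 hR0 y 0 (fun i => le_rfl) h0 κ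
  have hfar : hol R ((L : ℤ) • y + (boxVec L r + (L : ℤ) • e κ)) (revWord (treeWord (boxVec L r))) = 1 := by
    rw [hol_revWord' R (x := (L : ℤ) • (y + e κ)) ((L : ℤ) • y + (boxVec L r + (L : ℤ) • e κ)) (treeWord (boxVec L r))
        (by rw [disp_treeWord, smul_add]; abel),
      hol_treeWord_slab hL hR1 (y + e κ) _ hρ0 hρL, inv_one]
  rw [Wcx, gammaWord, hol_append, hol_append, disp_append, disp_treeWord, disp_seg, hol_treeWord_slab hL hR1 y _ hρ0 hρL,
    hol_seg_slab hL hR1 hR0 y _ hρ0 hρL κ, hfar, hsegc, one_mul, mul_one, mul_inv_cancel]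

/-- Hence the exponent `X_c` of (42) vanishes for the slab configuration. [folklore] -/
theorem Xavg_slab {L : ℕ} {D R : Site d → Fin d → (Matrix n n ℂ)ˣ} [NeZero L] (hL : 1 ≤ L) (hR1 : ∀ (x : Site d) (κ : Fin d), x κ % (L : ℤ) ≠ L - 1 → R x κ = 1)
    (hR0 : ∀ (x : Site d) (κ : Fin d), x κ % (L : ℤ) = L - 1 → R x κ = D (fun i => x i / (L : ℤ)) κ)
    (y : Site d) (κ : Fin d) : Xavg L R ((L : ℤ) • y) κ = 0 := by
  unfold Xavg
  exact Finset.sum_eq_zero fun r _ => by rw [Wcx_slab hL hR1 hR0 y κ r, Units.val_one, mlog_one, smul_zero]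

/-- **THE ONE-STEP AVERAGE (42) OF THE SLAB CONFIGURATION IS THE DATUM**: `(bavg L D₀)(⟨L•y, L•y + Le_κ⟩) = D y κ`. [folklore] -/
theorem bavg_slab {L : ℕ} {D R : Site d → Fin d → (Matrix n n ℂ)ˣ} [NeZero L] (hL : 1 ≤ L) (hR1 : ∀ (x : Site d) (κ : Fin d), x κ % (L : ℤ) ≠ L - 1 → R x κ = 1)
    (hR0 : ∀ (x : Site d) (κ : Fin d), x κ % (L : ℤ) = L - 1 → R x κ = D (fun i => x i / (L : ℤ)) κ)
    (y : Site d) (κ : Fin d) : bavg L R ((L : ℤ) • y) κ = D y κ := by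
  have h0 : ∀ i, (0 : Site d) i ≤ (L : ℤ) - 1 := fun i => by simp; omega
  have hsegc : hol R ((L : ℤ) • y) (seg κ (L : ℤ)) = D y κ := by
    simpa using hol_seg_slab hL hR1 hR0 y 0 (fun i => le_rfl) h0 κ
  have he : expUnit (Xavg L R ((L : ℤ) • y) κ) = 1 := by
    ext; rw [val_expUnit, Xavg_slab hL hR1 hR0 y κ, exp_zero, Units.val_one]
  rw [bavg, he, one_mul, hsegc]

/-- The average read on the next lattice: `rescale L (bavg L D₀) = D`. [folklore] -/
theorem rescale_bavg_slab {L : ℕ} {D R : Site d → Fin d → (Matrix n n ℂ)ˣ} [NeZero L] (hL : 1 ≤ L) (hR1 : ∀ (x : Site d) (κ : Fin d), x κ % (L : ℤ) ≠ L - 1 → R x κ = 1)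
    (hR0 : ∀ (x : Site d) (κ : Fin d), x κ % (L : ℤ) = L - 1 → R x κ = D (fun i => x i / (L : ℤ)) κ) :
    rescale L (bavg L R) = D := by
  funext y κ; rw [rescale_apply]; exact bavg_slab hL hR1 hR0 y κ

/-- Equivalently `avgIter L D₀ 1 = D` ((43) with one step). [folklore] -/
theorem avgIter_one_slab {L : ℕ} {D R : Site d → Fin d → (Matrix n n ℂ)ˣ} [NeZero L] (hL : 1 ≤ L) (hR1 : ∀ (x : Site d) (κ : Fin d), x κ % (L : ℤ) ≠ L - 1 → R x κ = 1)
    (hR0 : ∀ (x : Site d) (κ : Fin d), x κ % (L : ℤ) = L - 1 → R x κ = D (fun i => x i / (L : ℤ)) κ) :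
    avgIter L R 1 = D := by
  rw [avgIter_succ, avgIter_zero]; exact rescale_bavg_slab hL hR1 hR0

/-- The slab configuration is unitary with `D`. [folklore] -/
theorem isUnitaryCfg_slab {L : ℕ} {D R : Site d → Fin d → (Matrix n n ℂ)ˣ} (hR1 : ∀ (x : Site d) (κ : Fin d), x κ % (L : ℤ) ≠ L - 1 → R x κ = 1)
    (hR0 : ∀ (x : Site d) (κ : Fin d), x κ % (L : ℤ) = L - 1 → R x κ = D (fun i => x i / (L : ℤ)) κ) (hD : IsUnitaryCfg D) :
    IsUnitaryCfg R := by
  intro x κ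
  by_cases h : x κ % (L : ℤ) = L - 1
  · rw [hR0 x κ h]; exact hD _ κ
  · rw [hR1 x κ h]; exact (unitaryUnits (Matrix n n ℂ)).one_mem

/-- The slab configuration over an `N`-periodic datum is `N·L`-periodic. [folklore] -/
theorem isPeriodicCfg_slab {L : ℕ} {D R : Site d → Fin d → (Matrix n n ℂ)ˣ} (hL : 1 ≤ L) (hR1 : ∀ (x : Site d) (κ : Fin d), x κ % (L : ℤ) ≠ L - 1 → R x κ = 1)
    (hR0 : ∀ (x : Site d) (κ : Fin d), x κ % (L : ℤ) = L - 1 → R x κ = D (fun i => x i / (L : ℤ)) κ) {N : ℕ}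
    (hD : IsPeriodicCfg D (N : ℤ)) : IsPeriodicCfg R ((N * L : ℕ) : ℤ) := by
  have hL0 : (L : ℤ) ≠ 0 := by exact_mod_cast (by omega : L ≠ 0)
  intro x ι μ
  -- the shifted point has the same residues mod `L` and block index shifted by `N e_ι`
  have hres : (x + ((N * L : ℕ) : ℤ) • e ι) μ % (L : ℤ) = x μ % (L : ℤ) := by
    simp only [Pi.add_apply, Pi.smul_apply, smul_eq_mul, e_apply]
    split_ifs
    · rw [mul_one, show ((N * L : ℕ) : ℤ) = (L : ℤ) * N by push_cast; ring, Int.add_mul_emod_self_left]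
    · rw [mul_zero, add_zero]
  have hidx : (fun i => (x + ((N * L : ℕ) : ℤ) • e ι) i / (L : ℤ)) = (fun i => x i / (L : ℤ)) + (N : ℤ) • e ι := by
    funext i
    simp only [Pi.add_apply, Pi.smul_apply, smul_eq_mul, e_apply]
    split_ifs
    · rw [mul_one, mul_one, show ((N * L : ℕ) : ℤ) = (L : ℤ) * N by push_cast; ring, Int.add_mul_ediv_left _ _ hL0]
    · rw [mul_zero, mul_zero, add_zero, add_zero]
  by_cases h : x μ % (L : ℤ) = L - 1
  · rw [hR0 _ μ (hres.trans h), hR0 x μ h, hidx]; exact hD _ ι μ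
  · rw [hR1 _ μ (fun h' => h (hres.symm.trans h')), hR1 x μ h]

/-- **THE SLAB CONFIGURATION HAS THE PLAQUETTE RADIUS OF THE DATUM**: each of its fine plaquette variables is `1` or a plaquette variable of `D`
(at the corner of two last slabs). [folklore] -/
theorem smallField_slab {L : ℕ} {D R : Site d → Fin d → (Matrix n n ℂ)ˣ} (hL : 1 ≤ L) (hR1 : ∀ (x : Site d) (κ : Fin d), x κ % (L : ℤ) ≠ L - 1 → R x κ = 1)
    (hR0 : ∀ (x : Site d) (κ : Fin d), x κ % (L : ℤ) = L - 1 → R x κ = D (fun i => x i / (L : ℤ)) κ)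
    {a : ℝ} (ha : 0 ≤ a) (hD : SmallField D a) : SmallField R a := by
  have hL0 : (L : ℤ) ≠ 0 := by exact_mod_cast (by omega : L ≠ 0)
  intro x κ μ hκμ
  rw [hol_plaqWord_eq]
  -- residues and block indices of the two shifted corners
  set y : Site d := fun i => x i / (L : ℤ) with hy
  have hresκ : (x + e κ) μ = x μ := by simp [e_apply, hκμ.symm]
  have hresμ : (x + e μ) κ = x κ := by simp [e_apply, hκμ]
  -- block index of `x + e_ν` : shifted by `e_ν` iff `x_ν` is in the last slab
  have hidx : ∀ ν : Fin d, (fun i => (x + e ν) i / (L : ℤ)) = if x ν % (L : ℤ) = L - 1 then y + e ν else y := by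
    intro ν
    have hdiv := Int.emod_add_ediv_mul (x ν) (L : ℤ)   -- x ν % L + x ν / L * L = x ν
    have hlt : x ν % (L : ℤ) < L := Int.emod_lt_of_pos _ (by omega)
    have hnn : 0 ≤ x ν % (L : ℤ) := Int.emod_nonneg _ hL0
    -- the `ν`-coordinate of the block index of `x + e_ν`
    have hνν : (x ν + 1) / (L : ℤ) = if x ν % (L : ℤ) = L - 1 then x ν / (L : ℤ) + 1 else x ν / (L : ℤ) := by
      split_ifs with h
      · have h' : x ν + 1 = (L : ℤ) * (x ν / (L : ℤ) + 1) + 0 := by rw [h] at hdiv; linear_combination -hdiv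
        rw [h', (emod_ediv_block hL _ 0 le_rfl (by omega)).2]
      · have hlt' : x ν % (L : ℤ) + 1 < L := by
          have h1 : x ν % (L : ℤ) ≤ L - 1 := Int.le_sub_one_of_lt hlt
          have h2 : x ν % (L : ℤ) < L - 1 := lt_of_le_of_ne h1 h
          linarith
        have h' : x ν + 1 = (L : ℤ) * (x ν / (L : ℤ)) + (x ν % (L : ℤ) + 1) := by linear_combination -hdiv
        rw [h', (emod_ediv_block hL _ _ (by linarith) hlt').2]
    funext i
    by_cases hi : i = ν
    · subst hi
      have he : e i i = (1 : ℤ) := by simp [e_apply]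
      split_ifs with h
      · simp only [Pi.add_apply, he, hy]; rw [hνν, if_pos h]
      · simp only [Pi.add_apply, he, hy]; rw [hνν, if_neg h]
    · have he : e ν i = (0 : ℤ) := by simp [e_apply, hi]
      split_ifs <;> simp [Pi.add_apply, he, hy]
  by_cases hκ : x κ % (L : ℤ) = L - 1 <;> by_cases hμ : x μ % (L : ℤ) = L - 1
  · -- corner of two last slabs: the plaquette of `D` at the block index
    rw [hR0 x κ hκ, hR0 (x + e κ) μ (hresκ ▸ hμ), hR0 (x + e μ) κ (hresμ ▸ hκ), hR0 x μ hμ, hidx κ, hidx μ, if_pos hκ, if_pos hμ,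
      ← hy, ← hol_plaqWord_eq]
    exact hD y κ μ hκμ
  · rw [hR0 x κ hκ, hR1 (x + e κ) μ (hresκ ▸ hμ), hR0 (x + e μ) κ (hresμ ▸ hκ), hR1 x μ hμ, hidx μ, if_neg hμ, ← hy]
    simpa using ha
  · rw [hR1 x κ hκ, hR0 (x + e κ) μ (hresκ ▸ hμ), hR1 (x + e μ) κ (hresμ ▸ hκ), hR0 x μ hμ, hidx κ, if_neg hκ, ← hy]
    simpa using ha
  · rw [hR1 x κ hκ, hR1 (x + e κ) μ (hresκ ▸ hμ), hR1 (x + e μ) κ (hresμ ▸ hκ), hR1 x μ hμ]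
    simpa using ha

end Slab

/-! ## §3 The refinement of a datum and the re-reading of admissibility one level up -/

/-- **THE EXACT REFINEMENT OF A DATUM** ([Balaban1985Variational] Sect. A (11) for the tree's averaging (42)): every unitary `N`-periodic `D` with
`SmallField D a` (`a ≥ 0`, `L ≥ 1`) has a unitary `(N·L)`-periodic `D₀` with `SmallField D₀ a` whose one-step average read on the next lattice is
`D` exactly. [folklore] -/
theorem exists_datumRefinement {L N : ℕ} [NeZero L] (hL : 1 ≤ L) {D : Site d → Fin d → (Matrix n n ℂ)ˣ} (hDu : IsUnitaryCfg D)
    (hDP : IsPeriodicCfg D (N : ℤ)) {a : ℝ} (ha : 0 ≤ a) (hDa : SmallField D a) :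
    ∃ D₀ : Site d → Fin d → (Matrix n n ℂ)ˣ, IsUnitaryCfg D₀ ∧ IsPeriodicCfg D₀ ((N * L : ℕ) : ℤ) ∧ SmallField D₀ a ∧
      rescale L (bavg L D₀) = D ∧ avgIter L D₀ 1 = D := by
  classical
  let R : Site d → Fin d → (Matrix n n ℂ)ˣ := fun x κ => if x κ % (L : ℤ) = L - 1 then D (fun i => x i / (L : ℤ)) κ else 1
  have hR1 : ∀ (x : Site d) (κ : Fin d), x κ % (L : ℤ) ≠ L - 1 → R x κ = 1 := fun x κ h => if_neg h
  have hR0 : ∀ (x : Site d) (κ : Fin d), x κ % (L : ℤ) = L - 1 → R x κ = D (fun i => x i / (L : ℤ)) κ := fun x κ h => if_pos h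
  exact ⟨R, isUnitaryCfg_slab hR1 hR0 hDu, isPeriodicCfg_slab hL hR1 hR0 hDP, smallField_slab hL hR1 hR0 ha hDa,
    rescale_bavg_slab hL hR1 hR0, avgIter_one_slab hL hR1 hR0⟩

/-- **ADMISSIBILITY ONE LEVEL UP THROUGH THE TOP**: if `U₀` is admissible at level `j` over a datum `D₀` whose one-step average (read on the next
lattice) is `D`, and `U₀` lies in the class `𝒞 (j+1)`, then `U₀` is admissible at level `j+1` over `D` (`Ū^{j+1} = \overline{Ū^{j}} = D̄₀ = D`, (43)).
[cite: Balaban1985Averaging, (43) p.24] -/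
theorem mem_admissible_succ_of_top {𝒞 𝒞' : ℕ → Set (Site d → Fin d → (Matrix n n ℂ)ˣ)} {L j : ℕ} {D D₀ U₀ : Site d → Fin d → (Matrix n n ℂ)ˣ}
    (hU₀ : U₀ ∈ admissible 𝒞' L j D₀) (htop : rescale L (bavg L D₀) = D) (hcl : U₀ ∈ 𝒞 (j + 1)) :
    U₀ ∈ admissible 𝒞 L (j + 1) D :=
  ⟨hcl, by rw [avgIter_succ, hU₀.2, htop]⟩

/-- **THE SMALL-FIELD CLASS ONE LEVEL UP**: a configuration of `sfClass d L (N·L) ε j` (period `(N·L)·L^j = N·L^{j+1}`) whose plaquette radius is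
`δ₁∕(L^j)²` with `δ₁L² ≤ ε` lies in `sfClass d L N ε (j+1)` (radius `ε∕(L^{j+1})² ≥ δ₁∕(L^j)²`). [folklore] -/
theorem mem_sfClass_succ_of_mul {L N j : ℕ} (hL : 1 ≤ L) {ε δ₁ : ℝ} (hδε : δ₁ * (L : ℝ) ^ 2 ≤ ε) {U₀ : Site d → Fin d → (Matrix n n ℂ)ˣ}
    (hU₀ : U₀ ∈ sfClass d L (N * L) ε j) (hsm : SmallField U₀ (δ₁ / ((L : ℝ) ^ j) ^ 2)) :
    U₀ ∈ sfClass d L N ε (j + 1) := by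
  have hLpos : (0 : ℝ) < L := by exact_mod_cast (by omega : 0 < L)
  refine ⟨hU₀.1, ?_, MinimalActionRate.SmallField.mono hsm ?_⟩
  · have : ((N * L * L ^ j : ℕ) : ℤ) = ((N * L ^ (j + 1) : ℕ) : ℤ) := by push_cast; ring
    rw [← this]; exact hU₀.2.1
  · have h1 : ((L : ℝ) ^ (j + 1)) ^ 2 = ((L : ℝ) ^ j) ^ 2 * (L : ℝ) ^ 2 := by ring
    rw [h1, div_le_div_iff₀ (by positivity) (by positivity)]
    calc δ₁ * (((L : ℝ) ^ j) ^ 2 * (L : ℝ) ^ 2) = (δ₁ * (L : ℝ) ^ 2) * ((L : ℝ) ^ j) ^ 2 := by ring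
      _ ≤ ε * ((L : ℝ) ^ j) ^ 2 := mul_le_mul_of_nonneg_right hδε (by positivity)

/-- **THE RE-READING THAT DRIVES THE INDUCTION**: a level-`j` admissible configuration of the class over the refined datum (period `N·L`) with the good
radius `δ₁∕(L^j)²`, `δ₁L² ≤ ε`, IS a level-`(j+1)` admissible configuration of the class over the datum (period `N`) — with radius `(δ₁L²)∕(L^{j+1})²`.
[folklore] -/
theorem mem_admissible_sfClass_succ {L N j : ℕ} (hL : 1 ≤ L) {ε δ₁ : ℝ} (hδε : δ₁ * (L : ℝ) ^ 2 ≤ ε) {D D₀ U₀ : Site d → Fin d → (Matrix n n ℂ)ˣ}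
    (htop : rescale L (bavg L D₀) = D) (hU₀ : U₀ ∈ admissible (sfClass d L (N * L) ε) L j D₀)
    (hsm : SmallField U₀ (δ₁ / ((L : ℝ) ^ j) ^ 2)) :
    U₀ ∈ admissible (sfClass d L N ε) L (j + 1) D ∧ SmallField U₀ ((δ₁ * (L : ℝ) ^ 2) / ((L : ℝ) ^ (j + 1)) ^ 2) := by
  have hLpos : (0 : ℝ) < L := by exact_mod_cast (by omega : 0 < L)
  refine ⟨mem_admissible_succ_of_top hU₀ htop (mem_sfClass_succ_of_mul hL hδε hU₀.1 hsm), MinimalActionRate.SmallField.mono hsm (le_of_eq ?_)⟩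
  have h1 : ((L : ℝ) ^ (j + 1)) ^ 2 = ((L : ℝ) ^ j) ^ 2 * (L : ℝ) ^ 2 := by ring
  rw [h1]; field_simp

end

end Summit.QuantumFields.BalabanUV.T4Continuum.NE7DatumRefinement
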